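import Mathlib.Combinatorics.SimpleGraph.Paths
import Literature.AnabelianGeometry.SemiGraphs.SubdivisionLemmas
import Literature.AnabelianGeometry.SemiGraphs.FreeGroupsAndActionsProofs2

/-!
# Semi-graphs over a height function: the «first arrival» (critical vertex) of a walk

Mochizuki, *Semi-graphs of Anabelioids*, Publ. RIMS **42** (2006), §1 pp. 11–13 (the barycentric
subdivision `G.subdivision` of `SemiGraph.lean`) and Thm. 3.7 (iii) pp. 40–41
[cite: MochizukiSemiAnbd2006, Thm 3.7(iii) pp.40-41].

PROOF-ONLY file (no definitions), pure semi-graph combinatorics.  Context: the FRONTIER programme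
SUBDAG-REFUTE-F1732 of cell abc-iut (towards a kernel erratum for the ∀-countable reading of
[SemiAnbd] Thm. 3.7 (iii), [IUTchI] Rmk. 2.5.3; desk countermodel `𝒢_θ` by abc-iut-L3-d1, memo
COUNTERMODEL-Thm37iii-infinite.md; print proves the finite-semi-graph statement, kernel
`compactInVerticialAt_of_finiteGraph`).  This file is brick R6a (W) of abc-iut-L3-d4's SHAPES-R6.md
(sha16 eb4f45b76f0f25df), the model-free walk analysis behind step (2c) of the memo:

Let `T` be a semi-graph with a *height* `Ht : T.Vertex → ℕ` such that the two branches of every edge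
abut (when they abut) to vertices whose heights differ by EXACTLY one (`hstep`; e.g. the level trees
of a tempered tower over a ray, heights pulled back from the ray).  If a walk of the barycentric
subdivision runs from a vertex of height `≥ n + 2` to a vertex of height `≤ n` and every node it
visits satisfies a predicate `P` (e.g. «fixed by an automorphism»), then it has a *critical vertex*:
a vertex `v` of height `n + 1` carrying a branch `b` of an edge whose other branch abuts at height
`n + 2` and a branch `b'` of an edge whose other branch abuts at height `n`, the edge-points of both
edges satisfying `P` (`SemiGraph.exists_critical_of_walk`).  Proof: pass to the underlying path
(`SimpleGraph.Walk.bypass`); a path of the subdivision between vertex-points runs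
vertex → branch → edge → branch → vertex → ⋯ (`subdivision_adj_inl_iff` / `_edge_iff` /
`_branch_iff` of abc-iut-L3-t6's `SubdivisionLemmas.lean`), consecutive vertices differ in height by
exactly one, and the last descent from height `n + 1` to height `n` before the first arrival at
height `≤ n` is preceded by a descent from `n + 2` (`exists_critical_of_isPath`, induction on the
length with the «entered from above» witness carried along).

The hypothesis `hgr` («every branch abuts») of the SHAPES statement is not needed and is dropped;
everything else is the SHAPES signature verbatim.  Nothing here is asserted about any particular
semi-graph of anabelioids; nothing here bears on [IUTchIII] Cor. 3.12.
-/

namespace Literature.AnabelianGeometry.SemiGraphs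

namespace SemiGraph

universe u

variable (T : SemiGraph.{u})

/-- **First arrival, path form.**  For a PATH of the barycentric subdivision from the point of a
vertex `u` of height `≥ n + 1` to the point of a vertex `y` of height `≤ n`, all of whose nodes
satisfy `P`, and which — in case `Ht u = n + 1` — is handed a witness that `u` was «entered from
above» (a branch `b` at `u` of an edge with `P` at its edge-point and another branch at height
`n + 2`), there is a critical vertex of height `n + 1` as in `exists_critical_of_walk`.  Induction on
the length: a path leaves `inl u` through a branch-point, the edge-point of that branch, the other
branch-point of the edge and the vertex the latter abuts to, whose height is `Ht u ± 1` (`hstep`).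
[cite: MochizukiSemiAnbd2006, Thm 3.7(iii) pp.40-41] -/
theorem exists_critical_of_isPath (Ht : T.Vertex → ℕ)
    (hstep : ∀ (b₁ b₂ : T.Branch) (v₁ v₂ : T.Vertex), b₁ ≠ b₂ → T.edgeOf b₁ = T.edgeOf b₂ →
      T.abuts b₁ = some v₁ → T.abuts b₂ = some v₂ → Ht v₁ + 1 = Ht v₂ ∨ Ht v₂ + 1 = Ht v₁)
    (P : T.Node → Prop) (n : ℕ) {y : T.Vertex} (hy : Ht y ≤ n) :
    ∀ (L : ℕ) {u : T.Vertex} (p : T.subdivision.Walk (Sum.inl u) (Sum.inl y)), p.IsPath →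
      p.length ≤ L → (∀ z ∈ p.support, P z) → n + 1 ≤ Ht u →
      (Ht u = n + 1 → ∃ (b b₂ : T.Branch) (v₂ : T.Vertex), T.abuts b = some u ∧
        P (Sum.inr (Sum.inl (T.edgeOf b))) ∧ b₂ ≠ b ∧ T.edgeOf b₂ = T.edgeOf b ∧
        T.abuts b₂ = some v₂ ∧ Ht v₂ = n + 2) →
      ∃ (v : T.Vertex) (b b' : T.Branch), T.abuts b = some v ∧ T.abuts b' = some v ∧
        Ht v = n + 1 ∧ P (Sum.inr (Sum.inl (T.edgeOf b))) ∧ P (Sum.inr (Sum.inl (T.edgeOf b'))) ∧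
        (∃ (b₂ : T.Branch) (v₂ : T.Vertex), b₂ ≠ b ∧ T.edgeOf b₂ = T.edgeOf b ∧
          T.abuts b₂ = some v₂ ∧ Ht v₂ = n + 2) ∧
        (∃ (b₂ : T.Branch) (v₂ : T.Vertex), b₂ ≠ b' ∧ T.edgeOf b₂ = T.edgeOf b' ∧
          T.abuts b₂ = some v₂ ∧ Ht v₂ = n) := by
  intro L
  induction L with
  | zero =>
    intro u p _ hlen _ hu _
    have h0 : p.length = 0 := Nat.le_zero.mp hlen
    have huy : (Sum.inl u : T.Node) = Sum.inl y := SimpleGraph.Walk.eq_of_length_eq_zero h0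
    have : u = y := Sum.inl_injective huy
    subst this
    omega
  | succ L ih =>
    intro u p hp hlen hP hu hwit
    cases p with
    | nil => omega
    | cons h₁ p₁ =>
      rename_i z₁
      obtain ⟨b₁, hb₁u, rfl⟩ := (T.subdivision_adj_inl_iff u z₁).mp h₁
      rw [SimpleGraph.Walk.cons_isPath_iff] at hp
      obtain ⟨hp₁, hu_notMem⟩ := hp
      cases p₁ with
      | cons h₂ p₂ =>
        rename_i z₂
        rcases (T.subdivision_adj_branch_iff b₁ z₂).mp h₂ with rfl | ⟨v, hv, rfl⟩
        · -- the path continues through the edge-point of `b₁`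
          rw [SimpleGraph.Walk.cons_isPath_iff] at hp₁
          obtain ⟨hp₂, hb₁_notMem⟩ := hp₁
          cases p₂ with
          | cons h₃ p₃ =>
            rename_i z₃
            obtain ⟨b₃, hb₃e, rfl⟩ := (T.subdivision_adj_edge_iff (T.edgeOf b₁) z₃).mp h₃
            have hne : b₃ ≠ b₁ := by
              rintro rfl
              exact hb₁_notMem (by
                rw [SimpleGraph.Walk.support_cons]
                exact List.mem_cons_of_mem _ (SimpleGraph.Walk.start_mem_support p₃))
            rw [SimpleGraph.Walk.cons_isPath_iff] at hp₂
            obtain ⟨hp₃, he_notMem⟩ := hp₂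
            cases p₃ with
            | cons h₄ p₄ =>
              rename_i z₄
              rcases (T.subdivision_adj_branch_iff b₃ z₄).mp h₄ with rfl | ⟨u₄, hu₄, rfl⟩
              · -- back to the edge-point: excluded on a path
                exfalso
                apply he_notMem
                rw [SimpleGraph.Walk.support_cons]
                apply List.mem_cons_of_mem
                rw [← hb₃e]
                exact SimpleGraph.Walk.start_mem_support p₄
              · -- arrived at the vertex `u₄` across the edge of `b₁`, `b₃`
                rw [SimpleGraph.Walk.cons_isPath_iff] at hp₃
                obtain ⟨hp₄, -⟩ := hp₃
                have hlen₄ : p₄.length ≤ L := by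
                  simp only [SimpleGraph.Walk.length_cons] at hlen
                  omega
                have hPe : P (Sum.inr (Sum.inl (T.edgeOf b₁))) := by
                  apply hP
                  rw [SimpleGraph.Walk.support_cons, SimpleGraph.Walk.support_cons]
                  exact List.mem_cons_of_mem _ (List.mem_cons_of_mem _
                    (SimpleGraph.Walk.start_mem_support _))
                have hP₄ : ∀ z ∈ p₄.support, P z := by
                  intro z hz
                  apply hP
                  rw [SimpleGraph.Walk.support_cons, SimpleGraph.Walk.support_cons,
                    SimpleGraph.Walk.support_cons, SimpleGraph.Walk.support_cons]
                  exact List.mem_cons_of_mem _ (List.mem_cons_of_mem _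
                    (List.mem_cons_of_mem _ (List.mem_cons_of_mem _ hz)))
                rcases hstep b₃ b₁ u₄ u hne hb₃e hu₄ hb₁u with hdown | hup
                · -- descent: `Ht u₄ + 1 = Ht u`
                  by_cases h1 : Ht u = n + 1
                  · -- `u` is the critical vertex
                    obtain ⟨b, b₂, v₂, hbu, hPb, hb₂b, hb₂e, hb₂v, hv₂⟩ := hwit h1
                    exact ⟨u, b, b₁, hbu, hb₁u, h1, hPb, hPe, ⟨b₂, v₂, hb₂b, hb₂e, hb₂v, hv₂⟩,
                      ⟨b₃, u₄, hne, hb₃e, hu₄, by omega⟩⟩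
                  · -- `Ht u ≥ n + 2`: continue from `u₄`, entered from above through this edge
                    exact ih p₄ hp₄ hlen₄ hP₄ (by omega) fun h4 =>
                      ⟨b₃, b₁, u, hu₄, hb₃e ▸ hPe, fun h => hne h.symm, hb₃e.symm, hb₁u,
                        by omega⟩
                · -- ascent: `Ht u + 1 = Ht u₄`, continue from `u₄` (no witness needed)
                  exact ih p₄ hp₄ hlen₄ hP₄ (by omega) fun h4 => by omega
        · -- back to the vertex `u`: excluded on a path
          exfalso
          rw [hb₁u] at hv
          cases hv
          apply hu_notMem
          rw [SimpleGraph.Walk.support_cons]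
          exact List.mem_cons_of_mem _ (SimpleGraph.Walk.start_mem_support p₂)

/-- **First arrival (critical vertex) of a walk** — brick R6a (W) of SHAPES-R6.md (abc-iut-L3-d4),
the hypothesis «every branch abuts» dropped as unnecessary.  Let `Ht` be a height on the vertices of
a semi-graph `T` such that distinct branches of one edge abut to vertices of heights differing by
exactly one.  A walk of the barycentric subdivision from the point of a vertex `x` with
`n + 2 ≤ Ht x` to the point of a vertex `y` with `Ht y ≤ n`, every node of which satisfies `P`,
passes a vertex `v` of height `n + 1` together with branches `b`, `b'` at `v` such that the
edge-points of `edgeOf b` and `edgeOf b'` satisfy `P`, the edge of `b` has another branch abutting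
at height `n + 2`, and the edge of `b'` has another branch abutting at height `n`.
[cite: MochizukiSemiAnbd2006, Thm 3.7(iii) pp.40-41] -/
theorem exists_critical_of_walk (Ht : T.Vertex → ℕ)
    (hstep : ∀ (b₁ b₂ : T.Branch) (v₁ v₂ : T.Vertex), b₁ ≠ b₂ → T.edgeOf b₁ = T.edgeOf b₂ →
      T.abuts b₁ = some v₁ → T.abuts b₂ = some v₂ → Ht v₁ + 1 = Ht v₂ ∨ Ht v₂ + 1 = Ht v₁)
    (P : T.Node → Prop) (n : ℕ) {x y : T.Vertex} (hx : n + 2 ≤ Ht x) (hy : Ht y ≤ n)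
    (w : T.subdivision.Walk (Sum.inl x) (Sum.inl y)) (hw : ∀ z ∈ w.support, P z) :
    ∃ (v : T.Vertex) (b b' : T.Branch), T.abuts b = some v ∧ T.abuts b' = some v ∧ Ht v = n + 1 ∧
      P (Sum.inr (Sum.inl (T.edgeOf b))) ∧ P (Sum.inr (Sum.inl (T.edgeOf b'))) ∧
      (∃ (b₂ : T.Branch) (v₂ : T.Vertex), b₂ ≠ b ∧ T.edgeOf b₂ = T.edgeOf b ∧
        T.abuts b₂ = some v₂ ∧ Ht v₂ = n + 2) ∧
      (∃ (b₂ : T.Branch) (v₂ : T.Vertex), b₂ ≠ b' ∧ T.edgeOf b₂ = T.edgeOf b' ∧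
        T.abuts b₂ = some v₂ ∧ Ht v₂ = n) := by
  classical
  exact T.exists_critical_of_isPath Ht hstep P n hy w.bypass.length w.bypass w.bypass_isPath
    le_rfl (fun z hz => hw z (w.support_bypass_subset_support hz)) (by omega)
    (fun h => by omega)

/-! ### v2 (append-only): the fixed-point form on a tree -/

/-- **Critical vertex of an automorphism fixing a high and a low vertex of a TREE** (v2, append-only;
the form consumed by the escape criteria of SUBDAG-REFUTE-F1732 R6): if the semi-graph `T` is a tree,
`σ : Aut T` fixes a vertex `x` with `n + 2 ≤ Ht x` and a vertex `y` with `Ht y ≤ n`, then `σ` fixes the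
geodesic between them ([SemiAnbd] Lem. 1.8 (ii)(b), `nodeMap_eq_self_of_isPath`), so by
`exists_critical_of_walk` there is a vertex `v` of height `n + 1` with branches `b`, `b'` at `v` whose
EDGES are `σ`-fixed, the edge of `b` reaching height `n + 2` and the edge of `b'` reaching height `n`.
[cite: MochizukiSemiAnbd2006, Thm 3.7(iii) pp.40-41] -/
theorem exists_fixed_critical_of_isTree (hT : T.IsTree) (Ht : T.Vertex → ℕ)
    (hstep : ∀ (b₁ b₂ : T.Branch) (v₁ v₂ : T.Vertex), b₁ ≠ b₂ → T.edgeOf b₁ = T.edgeOf b₂ →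
      T.abuts b₁ = some v₁ → T.abuts b₂ = some v₂ → Ht v₁ + 1 = Ht v₂ ∨ Ht v₂ + 1 = Ht v₁)
    (σ : CategoryTheory.Aut T) (n : ℕ) {x y : T.Vertex} (hx : n + 2 ≤ Ht x) (hy : Ht y ≤ n)
    (hσx : σ.hom.vertexMap x = x) (hσy : σ.hom.vertexMap y = y) :
    ∃ (v : T.Vertex) (b b' : T.Branch), T.abuts b = some v ∧ T.abuts b' = some v ∧ Ht v = n + 1 ∧
      σ.hom.edgeMap (T.edgeOf b) = T.edgeOf b ∧ σ.hom.edgeMap (T.edgeOf b') = T.edgeOf b' ∧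
      (∃ (b₂ : T.Branch) (v₂ : T.Vertex), b₂ ≠ b ∧ T.edgeOf b₂ = T.edgeOf b ∧
        T.abuts b₂ = some v₂ ∧ Ht v₂ = n + 2) ∧
      (∃ (b₂ : T.Branch) (v₂ : T.Vertex), b₂ ≠ b' ∧ T.edgeOf b₂ = T.edgeOf b' ∧
        T.abuts b₂ = some v₂ ∧ Ht v₂ = n) := by
  classical
  obtain ⟨w⟩ := hT.isTree.connected (Sum.inl x : T.Node) (Sum.inl y)
  have hfix : ∀ z ∈ w.bypass.support, nodeMap σ z = z :=
    nodeMap_eq_self_of_isPath hT.isTree.isAcyclic σ (by rw [nodeMap_inl, hσx])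
      (by rw [nodeMap_inl, hσy]) w.bypass
      w.bypass_isPath
  obtain ⟨v, b, b', hb, hb', hv, hPb, hPb', hup, hdown⟩ :=
    T.exists_critical_of_walk Ht hstep (fun z => nodeMap σ z = z) n hx hy w.bypass hfix
  refine ⟨v, b, b', hb, hb', hv, ?_, ?_, hup, hdown⟩
  · simpa using hPb
  · simpa using hPb'

/-- The same for a FAMILY of automorphisms (e.g. the image of a compact subgroup at one level of a
tempered tower): common fixed vertices `x` (height `≥ n + 2`) and `y` (height `≤ n`) of all `ρ i` on a
tree yield a critical vertex of height `n + 1` whose two critical edges are fixed by every `ρ i`.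
[cite: MochizukiSemiAnbd2006, Thm 3.7(iii) pp.40-41] -/
theorem exists_fixed_critical_of_isTree_family (hT : T.IsTree) (Ht : T.Vertex → ℕ)
    (hstep : ∀ (b₁ b₂ : T.Branch) (v₁ v₂ : T.Vertex), b₁ ≠ b₂ → T.edgeOf b₁ = T.edgeOf b₂ →
      T.abuts b₁ = some v₁ → T.abuts b₂ = some v₂ → Ht v₁ + 1 = Ht v₂ ∨ Ht v₂ + 1 = Ht v₁)
    {ι : Type*} (ρ : ι → CategoryTheory.Aut T) (n : ℕ) {x y : T.Vertex} (hx : n + 2 ≤ Ht x) (hy : Ht y ≤ n)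
    (hρx : ∀ i, (ρ i).hom.vertexMap x = x) (hρy : ∀ i, (ρ i).hom.vertexMap y = y) :
    ∃ (v : T.Vertex) (b b' : T.Branch), T.abuts b = some v ∧ T.abuts b' = some v ∧ Ht v = n + 1 ∧
      (∀ i, (ρ i).hom.edgeMap (T.edgeOf b) = T.edgeOf b) ∧
      (∀ i, (ρ i).hom.edgeMap (T.edgeOf b') = T.edgeOf b') ∧
      (∃ (b₂ : T.Branch) (v₂ : T.Vertex), b₂ ≠ b ∧ T.edgeOf b₂ = T.edgeOf b ∧
        T.abuts b₂ = some v₂ ∧ Ht v₂ = n + 2) ∧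
      (∃ (b₂ : T.Branch) (v₂ : T.Vertex), b₂ ≠ b' ∧ T.edgeOf b₂ = T.edgeOf b' ∧
        T.abuts b₂ = some v₂ ∧ Ht v₂ = n) := by
  classical
  obtain ⟨w⟩ := hT.isTree.connected (Sum.inl x : T.Node) (Sum.inl y)
  have hfix : ∀ z ∈ w.bypass.support, ∀ i, nodeMap (ρ i) z = z := fun z hz i =>
    nodeMap_eq_self_of_isPath hT.isTree.isAcyclic (ρ i) (by rw [nodeMap_inl, hρx i])
      (by rw [nodeMap_inl, hρy i]) w.bypass
      w.bypass_isPath z hz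
  obtain ⟨v, b, b', hb, hb', hv, hPb, hPb', hup, hdown⟩ :=
    T.exists_critical_of_walk Ht hstep (fun z => ∀ i, nodeMap (ρ i) z = z) n hx hy w.bypass hfix
  refine ⟨v, b, b', hb, hb', hv, ?_, ?_, hup, hdown⟩
  · intro i
    simpa using hPb i
  · intro i
    simpa using hPb' i

end SemiGraph

end Literature.AnabelianGeometry.SemiGraphs
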